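/-
COR-CM (cell pub-hodgecm2, stage 2 of the Hodge ladder) — count-neutral KERNEL COMBINATORICS «the named composite cyclotomic fields, exact»
(seat prover-pub-hodgecm2-b23-g39-0, binder prover b23, gen 39; claim ABELIAN-DATUM D5, HOME/INBOX.md l.9517; blanket `CorCM/FaceCyclotomic*`).
Theorems only: D4 `CorCM/FaceAbelianExact.lean` (`isLeast_card_faces_hgen_cyclotomic_of_unitTable_even`) with gen 37's orbit numerals
(`Census/EvenSliceOrbitCount{,B}.lean`) BY NAME; unit tables by `decide +kernel`; no geometry, no named fact, nothing asserted; `Interfaces.lean`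
(C1), every E term, B01 and `Transposition/*` are untouched.
HONEST FRAMING (COORDINATOR RULING — HODGE FRAMING CORRECTION, 2026-08-21T11:55:35Z): `HC_CM` is NOT proved, here or anywhere in the
tree; this file counts faces and produces no period.
T5: n/a-class — no HC-level conclusion; checker: self (prover-pub-hodgecm2-b23-g39-0), 2026-08-22.
-/
import Summits.HodgeConjecture.CorCM.FaceAbelianExact
import Summits.HodgeConjecture.CorCM.Census.EvenSliceOrbitCount
import Summits.HodgeConjecture.CorCM.Census.EvenSliceOrbitCountB
import HarnessLib

/-!
# The named composite cyclotomic CM fields, exact: `ℚ(ζ₁₅), ℚ(ζ₁₆), ℚ(ζ₂₀), ℚ(ζ₂₄), ℚ(ζ₂₁), ℚ(ζ₂₈), ℚ(ζ₃₂), ℚ(ζ₃₆)`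

For each field `K` (ANY CM field with `[IsCyclotomicExtension {N} ℚ K]`, no further hypothesis) and every base embedding `σ₀`, the least
number of rank-four faces of `K` whose Weil characters at all base embeddings generate those of every face of `K` (the INT2-GEN binder
`hgen(𝒮, σ₀)`) is EXACTLY `#OrbitsA A − 1 = β(K) − 2`:

| `N` | `[K:ℚ]` | `A ≅ Gal(K⁺/ℚ)` | `#OrbitsA A` | `β(K)` | least #faces |
|---|---|---|---|---|---|
| 15 | 8 | `ZMod 4` | 3 | 4 | **2** |
| 16 | 8 | `ZMod 4` | 3 | 4 | **2** |
| 20 | 8 | `ZMod 4` | 3 | 4 | **2** |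
| 24 | 8 | `ZMod 2 × ZMod 2` | 4 | 5 | **3** |
| 21 | 12 | `ZMod 6` | 7 | 8 | **6** |
| 28 | 12 | `ZMod 6` | 7 | 8 | **6** |
| 32 | 16 | `ZMod 8` | 19 | 20 | **18** |
| 36 | 12 | `ZMod 6` | 7 | 8 | **6** |

(existence: gen 37's canonical squares transported datum-free, D2/D3; floor: seat b09's `FaceCoinvariantComplement` XIV through D4's
`card_block_eq_card_orbitsA_add_one` and `exists_cpl_of_datum`.)  Companion: `CorCM/FaceCyclotomicCompositeExactB.lean` (`N = 33, 44, 35, 39, 45, 40, 48, 60`).  `HC_CM` is NOT proved; no period is produced.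

References: [cite: Washington1997, Thm. 2.5]; [cite: Pohlmann1968, Thm. 1]; [cite: Milne1999LefschetzClasses, Thm. 3.2, Prop. 2.1];
[cite: Shimura1998, §8.1 (p. 62)].
-/

noncomputable section

open NumberField NumberField.ComplexEmbedding

namespace Summit.HodgeConjecture.CorCM.FaceAbelian

open Literature.AlgebraicGeometry.Motives (CMType)
open Summit.HodgeConjecture.CorCM.Prior.AllgGroup.RfwfAllgGroup
open Summit.HodgeConjecture.CorCM.Census.OddDegreeParityLaw (OrbitsA)
open Summit.HodgeConjecture.CorCM.Census.EvenSliceOrbitCount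

/-- **`ℚ(ζ₁₅)`: EXACTLY `2` generating faces, none fewer** (`A ≅ ℤ/4`, `3` orbits, `β = 4`), for every base
embedding — no datum hypothesis. [cite: Pohlmann1968, Thm. 1] [cite: Milne1999LefschetzClasses, Thm. 3.2] [cite: Washington1997, Thm. 2.5] -/
theorem isLeast_card_faces_hgen_cyclotomic_fifteen (K : CMField) [IsCyclotomicExtension {15} ℚ (K : Type)]
    (σ₀ : (K : Type) →+* ℂ) :
    IsLeast {m : ℕ | ∃ 𝒮 : Finset (Face K), 𝒮.card = m ∧
      ∀ f : Face K, lefChar f.corner (fun _ => ({σ₀} : Finset ((K : Type) →+* ℂ))) ∈ AddSubgroup.closure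
        {a : Asym K | ∃ g ∈ (𝒮 : Set (Face K)), ∃ σ : (K : Type) →+* ℂ, a = lefChar g.corner (fun _ => ({σ} : Finset ((K : Type) →+* ℂ)))}}
      2 := by
  have h := isLeast_card_faces_hgen_cyclotomic_of_unitTable_even (F := (K : Type)) (N := 15) (A := ZMod 4) (by decide +kernel)
    (fun u : (ZMod 15)ˣ =>
      if (u : ZMod 15).val = 1 ∨ (u : ZMod 15).val = 14 then (0 : ZMod 4) else
      if (u : ZMod 15).val = 2 ∨ (u : ZMod 15).val = 13 then (1 : ZMod 4) else
      if (u : ZMod 15).val = 4 ∨ (u : ZMod 15).val = 11 then (2 : ZMod 4) else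
      (3 : ZMod 4))
    (by decide +kernel) (by decide +kernel) (by decide +kernel) (by decide +kernel) (by simp only [ZMod.card]; decide) (by simp only [ZMod.card]; norm_num) σ₀
  rwa [← Nat.card_eq_fintype_card, card_orbitsA_zmod_four] at h

/-- **`ℚ(ζ₁₆)`: EXACTLY `2` generating faces, none fewer** (`A ≅ ℤ/4`, `3` orbits, `β = 4`), for every base
embedding — no datum hypothesis. [cite: Pohlmann1968, Thm. 1] [cite: Milne1999LefschetzClasses, Thm. 3.2] [cite: Washington1997, Thm. 2.5] -/
theorem isLeast_card_faces_hgen_cyclotomic_sixteen (K : CMField) [IsCyclotomicExtension {16} ℚ (K : Type)]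
    (σ₀ : (K : Type) →+* ℂ) :
    IsLeast {m : ℕ | ∃ 𝒮 : Finset (Face K), 𝒮.card = m ∧
      ∀ f : Face K, lefChar f.corner (fun _ => ({σ₀} : Finset ((K : Type) →+* ℂ))) ∈ AddSubgroup.closure
        {a : Asym K | ∃ g ∈ (𝒮 : Set (Face K)), ∃ σ : (K : Type) →+* ℂ, a = lefChar g.corner (fun _ => ({σ} : Finset ((K : Type) →+* ℂ)))}}
      2 := by
  have h := isLeast_card_faces_hgen_cyclotomic_of_unitTable_even (F := (K : Type)) (N := 16) (A := ZMod 4) (by decide +kernel)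
    (fun u : (ZMod 16)ˣ =>
      if (u : ZMod 16).val = 1 ∨ (u : ZMod 16).val = 15 then (0 : ZMod 4) else
      if (u : ZMod 16).val = 3 ∨ (u : ZMod 16).val = 13 then (1 : ZMod 4) else
      if (u : ZMod 16).val = 7 ∨ (u : ZMod 16).val = 9 then (2 : ZMod 4) else
      (3 : ZMod 4))
    (by decide +kernel) (by decide +kernel) (by decide +kernel) (by decide +kernel) (by simp only [ZMod.card]; decide) (by simp only [ZMod.card]; norm_num) σ₀
  rwa [← Nat.card_eq_fintype_card, card_orbitsA_zmod_four] at h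

/-- **`ℚ(ζ₂₀)`: EXACTLY `2` generating faces, none fewer** (`A ≅ ℤ/4`, `3` orbits, `β = 4`), for every base
embedding — no datum hypothesis. [cite: Pohlmann1968, Thm. 1] [cite: Milne1999LefschetzClasses, Thm. 3.2] [cite: Washington1997, Thm. 2.5] -/
theorem isLeast_card_faces_hgen_cyclotomic_twenty (K : CMField) [IsCyclotomicExtension {20} ℚ (K : Type)]
    (σ₀ : (K : Type) →+* ℂ) :
    IsLeast {m : ℕ | ∃ 𝒮 : Finset (Face K), 𝒮.card = m ∧
      ∀ f : Face K, lefChar f.corner (fun _ => ({σ₀} : Finset ((K : Type) →+* ℂ))) ∈ AddSubgroup.closure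
        {a : Asym K | ∃ g ∈ (𝒮 : Set (Face K)), ∃ σ : (K : Type) →+* ℂ, a = lefChar g.corner (fun _ => ({σ} : Finset ((K : Type) →+* ℂ)))}}
      2 := by
  have h := isLeast_card_faces_hgen_cyclotomic_of_unitTable_even (F := (K : Type)) (N := 20) (A := ZMod 4) (by decide +kernel)
    (fun u : (ZMod 20)ˣ =>
      if (u : ZMod 20).val = 1 ∨ (u : ZMod 20).val = 19 then (0 : ZMod 4) else
      if (u : ZMod 20).val = 3 ∨ (u : ZMod 20).val = 17 then (1 : ZMod 4) else
      if (u : ZMod 20).val = 9 ∨ (u : ZMod 20).val = 11 then (2 : ZMod 4) else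
      (3 : ZMod 4))
    (by decide +kernel) (by decide +kernel) (by decide +kernel) (by decide +kernel) (by simp only [ZMod.card]; decide) (by simp only [ZMod.card]; norm_num) σ₀
  rwa [← Nat.card_eq_fintype_card, card_orbitsA_zmod_four] at h

/-- **`ℚ(ζ₂₄)`: EXACTLY `3` generating faces, none fewer** (`A ≅ ℤ/2 × ℤ/2`, `4` orbits, `β = 5`), for every base
embedding — no datum hypothesis. [cite: Pohlmann1968, Thm. 1] [cite: Milne1999LefschetzClasses, Thm. 3.2] [cite: Washington1997, Thm. 2.5] -/
theorem isLeast_card_faces_hgen_cyclotomic_twentyFour (K : CMField) [IsCyclotomicExtension {24} ℚ (K : Type)]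
    (σ₀ : (K : Type) →+* ℂ) :
    IsLeast {m : ℕ | ∃ 𝒮 : Finset (Face K), 𝒮.card = m ∧
      ∀ f : Face K, lefChar f.corner (fun _ => ({σ₀} : Finset ((K : Type) →+* ℂ))) ∈ AddSubgroup.closure
        {a : Asym K | ∃ g ∈ (𝒮 : Set (Face K)), ∃ σ : (K : Type) →+* ℂ, a = lefChar g.corner (fun _ => ({σ} : Finset ((K : Type) →+* ℂ)))}}
      3 := by
  have h := isLeast_card_faces_hgen_cyclotomic_of_unitTable_even (F := (K : Type)) (N := 24) (A := ZMod 2 × ZMod 2) (by decide +kernel)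
    (fun u : (ZMod 24)ˣ =>
      if (u : ZMod 24).val = 1 ∨ (u : ZMod 24).val = 23 then ((0, 0) : ZMod 2 × ZMod 2) else
      if (u : ZMod 24).val = 7 ∨ (u : ZMod 24).val = 17 then ((0, 1) : ZMod 2 × ZMod 2) else
      if (u : ZMod 24).val = 5 ∨ (u : ZMod 24).val = 19 then ((1, 0) : ZMod 2 × ZMod 2) else
      ((1, 1) : ZMod 2 × ZMod 2))
    (by decide +kernel) (by decide +kernel) (by decide +kernel) (by decide +kernel) (by simp only [Fintype.card_prod, ZMod.card]; decide) (by simp only [Fintype.card_prod, ZMod.card]; norm_num) σ₀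
  rwa [← Nat.card_eq_fintype_card, card_orbitsA_zmod_two_sq] at h

/-- **`ℚ(ζ₂₁)`: EXACTLY `6` generating faces, none fewer** (`A ≅ ℤ/6`, `7` orbits, `β = 8`), for every base
embedding — no datum hypothesis. [cite: Pohlmann1968, Thm. 1] [cite: Milne1999LefschetzClasses, Thm. 3.2] [cite: Washington1997, Thm. 2.5] -/
theorem isLeast_card_faces_hgen_cyclotomic_twentyOne (K : CMField) [IsCyclotomicExtension {21} ℚ (K : Type)]
    (σ₀ : (K : Type) →+* ℂ) :
    IsLeast {m : ℕ | ∃ 𝒮 : Finset (Face K), 𝒮.card = m ∧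
      ∀ f : Face K, lefChar f.corner (fun _ => ({σ₀} : Finset ((K : Type) →+* ℂ))) ∈ AddSubgroup.closure
        {a : Asym K | ∃ g ∈ (𝒮 : Set (Face K)), ∃ σ : (K : Type) →+* ℂ, a = lefChar g.corner (fun _ => ({σ} : Finset ((K : Type) →+* ℂ)))}}
      6 := by
  have h := isLeast_card_faces_hgen_cyclotomic_of_unitTable_even (F := (K : Type)) (N := 21) (A := ZMod 6) (by decide +kernel)
    (fun u : (ZMod 21)ˣ =>
      if (u : ZMod 21).val = 1 ∨ (u : ZMod 21).val = 20 then (0 : ZMod 6) else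
      if (u : ZMod 21).val = 2 ∨ (u : ZMod 21).val = 19 then (1 : ZMod 6) else
      if (u : ZMod 21).val = 4 ∨ (u : ZMod 21).val = 17 then (2 : ZMod 6) else
      if (u : ZMod 21).val = 8 ∨ (u : ZMod 21).val = 13 then (3 : ZMod 6) else
      if (u : ZMod 21).val = 5 ∨ (u : ZMod 21).val = 16 then (4 : ZMod 6) else
      (5 : ZMod 6))
    (by decide +kernel) (by decide +kernel) (by decide +kernel) (by decide +kernel) (by simp only [ZMod.card]; decide) (by simp only [ZMod.card]; norm_num) σ₀
  rwa [← Nat.card_eq_fintype_card, card_orbitsA_zmod_six] at h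

/-- **`ℚ(ζ₂₈)`: EXACTLY `6` generating faces, none fewer** (`A ≅ ℤ/6`, `7` orbits, `β = 8`), for every base
embedding — no datum hypothesis. [cite: Pohlmann1968, Thm. 1] [cite: Milne1999LefschetzClasses, Thm. 3.2] [cite: Washington1997, Thm. 2.5] -/
theorem isLeast_card_faces_hgen_cyclotomic_twentyEight (K : CMField) [IsCyclotomicExtension {28} ℚ (K : Type)]
    (σ₀ : (K : Type) →+* ℂ) :
    IsLeast {m : ℕ | ∃ 𝒮 : Finset (Face K), 𝒮.card = m ∧
      ∀ f : Face K, lefChar f.corner (fun _ => ({σ₀} : Finset ((K : Type) →+* ℂ))) ∈ AddSubgroup.closure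
        {a : Asym K | ∃ g ∈ (𝒮 : Set (Face K)), ∃ σ : (K : Type) →+* ℂ, a = lefChar g.corner (fun _ => ({σ} : Finset ((K : Type) →+* ℂ)))}}
      6 := by
  have h := isLeast_card_faces_hgen_cyclotomic_of_unitTable_even (F := (K : Type)) (N := 28) (A := ZMod 6) (by decide +kernel)
    (fun u : (ZMod 28)ˣ =>
      if (u : ZMod 28).val = 1 ∨ (u : ZMod 28).val = 27 then (0 : ZMod 6) else
      if (u : ZMod 28).val = 5 ∨ (u : ZMod 28).val = 23 then (1 : ZMod 6) else
      if (u : ZMod 28).val = 3 ∨ (u : ZMod 28).val = 25 then (2 : ZMod 6) else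
      if (u : ZMod 28).val = 13 ∨ (u : ZMod 28).val = 15 then (3 : ZMod 6) else
      if (u : ZMod 28).val = 9 ∨ (u : ZMod 28).val = 19 then (4 : ZMod 6) else
      (5 : ZMod 6))
    (by decide +kernel) (by decide +kernel) (by decide +kernel) (by decide +kernel) (by simp only [ZMod.card]; decide) (by simp only [ZMod.card]; norm_num) σ₀
  rwa [← Nat.card_eq_fintype_card, card_orbitsA_zmod_six] at h

/-- **`ℚ(ζ₃₂)`: EXACTLY `18` generating faces, none fewer** (`A ≅ ℤ/8`, `19` orbits, `β = 20`), for every base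
embedding — no datum hypothesis. [cite: Pohlmann1968, Thm. 1] [cite: Milne1999LefschetzClasses, Thm. 3.2] [cite: Washington1997, Thm. 2.5] -/
theorem isLeast_card_faces_hgen_cyclotomic_thirtyTwo (K : CMField) [IsCyclotomicExtension {32} ℚ (K : Type)]
    (σ₀ : (K : Type) →+* ℂ) :
    IsLeast {m : ℕ | ∃ 𝒮 : Finset (Face K), 𝒮.card = m ∧
      ∀ f : Face K, lefChar f.corner (fun _ => ({σ₀} : Finset ((K : Type) →+* ℂ))) ∈ AddSubgroup.closure
        {a : Asym K | ∃ g ∈ (𝒮 : Set (Face K)), ∃ σ : (K : Type) →+* ℂ, a = lefChar g.corner (fun _ => ({σ} : Finset ((K : Type) →+* ℂ)))}}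
      18 := by
  have h := isLeast_card_faces_hgen_cyclotomic_of_unitTable_even (F := (K : Type)) (N := 32) (A := ZMod 8) (by decide +kernel)
    (fun u : (ZMod 32)ˣ =>
      if (u : ZMod 32).val = 1 ∨ (u : ZMod 32).val = 31 then (0 : ZMod 8) else
      if (u : ZMod 32).val = 3 ∨ (u : ZMod 32).val = 29 then (1 : ZMod 8) else
      if (u : ZMod 32).val = 9 ∨ (u : ZMod 32).val = 23 then (2 : ZMod 8) else
      if (u : ZMod 32).val = 5 ∨ (u : ZMod 32).val = 27 then (3 : ZMod 8) else
      if (u : ZMod 32).val = 15 ∨ (u : ZMod 32).val = 17 then (4 : ZMod 8) else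
      if (u : ZMod 32).val = 13 ∨ (u : ZMod 32).val = 19 then (5 : ZMod 8) else
      if (u : ZMod 32).val = 7 ∨ (u : ZMod 32).val = 25 then (6 : ZMod 8) else
      (7 : ZMod 8))
    (by decide +kernel) (by decide +kernel) (by decide +kernel) (by decide +kernel) (by simp only [ZMod.card]; decide) (by simp only [ZMod.card]; norm_num) σ₀
  rwa [← Nat.card_eq_fintype_card, card_orbitsA_zmod_eight] at h

/-- **`ℚ(ζ₃₆)`: EXACTLY `6` generating faces, none fewer** (`A ≅ ℤ/6`, `7` orbits, `β = 8`), for every base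
embedding — no datum hypothesis. [cite: Pohlmann1968, Thm. 1] [cite: Milne1999LefschetzClasses, Thm. 3.2] [cite: Washington1997, Thm. 2.5] -/
theorem isLeast_card_faces_hgen_cyclotomic_thirtySix (K : CMField) [IsCyclotomicExtension {36} ℚ (K : Type)]
    (σ₀ : (K : Type) →+* ℂ) :
    IsLeast {m : ℕ | ∃ 𝒮 : Finset (Face K), 𝒮.card = m ∧
      ∀ f : Face K, lefChar f.corner (fun _ => ({σ₀} : Finset ((K : Type) →+* ℂ))) ∈ AddSubgroup.closure
        {a : Asym K | ∃ g ∈ (𝒮 : Set (Face K)), ∃ σ : (K : Type) →+* ℂ, a = lefChar g.corner (fun _ => ({σ} : Finset ((K : Type) →+* ℂ)))}}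
      6 := by
  have h := isLeast_card_faces_hgen_cyclotomic_of_unitTable_even (F := (K : Type)) (N := 36) (A := ZMod 6) (by decide +kernel)
    (fun u : (ZMod 36)ˣ =>
      if (u : ZMod 36).val = 1 ∨ (u : ZMod 36).val = 35 then (0 : ZMod 6) else
      if (u : ZMod 36).val = 5 ∨ (u : ZMod 36).val = 31 then (1 : ZMod 6) else
      if (u : ZMod 36).val = 11 ∨ (u : ZMod 36).val = 25 then (2 : ZMod 6) else
      if (u : ZMod 36).val = 17 ∨ (u : ZMod 36).val = 19 then (3 : ZMod 6) else
      if (u : ZMod 36).val = 13 ∨ (u : ZMod 36).val = 23 then (4 : ZMod 6) else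
      (5 : ZMod 6))
    (by decide +kernel) (by decide +kernel) (by decide +kernel) (by decide +kernel) (by simp only [ZMod.card]; decide) (by simp only [ZMod.card]; norm_num) σ₀
  rwa [← Nat.card_eq_fintype_card, card_orbitsA_zmod_six] at h

end Summit.HodgeConjecture.CorCM.FaceAbelian

end
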